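import Mathlib
import HarnessLib
import Summits.NavierStokesRegularity.NavierStokesRegularity.Theorems.PoloidalWindowDoorPoloidalWindowRigiditySparseEnergyWindowSplit

/-!
# Route `PoloidalWindowDoor`, crux `PoloidalWindowRigidity` (stmt-19708), line `sparse_energy` (cstrat g11) —
# STUB S1 `stub_scaledEnergy` PROVED: TYPE-I IN TIME ⇒ BOUNDED SCALE-INVARIANT ENERGY AT EVERY INTERIOR SCALE

Seat ns-poloidal-K2-p2 g10 (LEAD-lineage on 19708).  The statement is `Cruxes/PoloidalWindowRigidity/Lines/sparse_energy.lean`,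
`stub_scaledEnergy` (l. 74–84) VERBATIM.  Proof = the chain of the K2-p2 lineage and ns-es-p1:

* far from the apex `…SparseEnergyFarField.scaledEnergy_far` (K2-p2 g9);
* near the apex, three power-law rounds of the cut-off local energy inequality `…SparseEnergyRounds.envelope_zero` (K2-p2 g9), CONDITIONAL on
  the window pressure split `hwin`, assembled in `…SparseEnergyScaledEnergyOfSplit.scaledEnergy_of_split` (K2-p2 g9);
* `hwin` for the Type-I class = `…SparseEnergyWindowSplit.window_split` (K2-p2 g10; FILE C: C1 K2-p2 g9 `…PressureScale`, C2/C5 + slice split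
  ns-es-p1 g4 `…PressureSplitNear`, C3/C4 ns-es-p1 g4 `…PressureSplitFar` / K2-p2 g10 `…FarKernel`·`…FarOscillation`, identification
  ns-es-p1 g4 `Literature/Analysis/FluidPDE/OseenMildPressureIdentification` over the Riesz-pressure brick `RieszPressureModConst*`).

Nearest print: Seregin, *Lecture Notes on Regularity Theory for the Navier–Stokes Equations* (2014), Prop. 3.11 / Prop. 6.20 (suitable weak
solutions near a Type-I point); here: the abstract Type-I ancient mild class, interior cylinders reaching `−∞`, uniform up to the apex, and
the pressure of a bounded mild solution identified with the Riesz pressure modulo constants (KNSS 2009 §4; Seregin 2014 §6.3).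

WHAT THIS IS NOT: not a claim about Navier–Stokes regularity or blow-up; it does NOT close crux 19708 (the residue of line sparse_energy is
`stub_twistingSparse`); an a-priori estimate for hypothetical Type-I ancient profiles (bears_on LADDER-NS N0 via crux 19708, line sparse_energy,
stub S1). [folklore]
-/

noncomputable section

-- the summit and its single sub-problem share the name (CONVENTIONS §1), as in every Theorems file
set_option linter.dupNamespace false

namespace Summit.NavierStokesRegularity.NavierStokesRegularity.Theorems.PoloidalWindowDoorPoloidalWindowRigiditySparseEnergyScaledEnergy

open MeasureTheory Set Function Filter Topology Metric
open scoped ENNReal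
open Literature.Analysis Literature.Analysis.FluidPDE
open Summit.NavierStokesRegularity.NavierStokesRegularity.Theorems.PoloidalWindowDoorPoloidalWindowRigiditySparseEnergyScaledEnergyOfSplit
open Summit.NavierStokesRegularity.NavierStokesRegularity.Theorems.PoloidalWindowDoorPoloidalWindowRigiditySparseEnergyWindowSplit

/-- **STUB S1 (`stub_scaledEnergy`) — TYPE-I IN TIME ⇒ BOUNDED SCALE-INVARIANT ENERGY AT EVERY INTERIOR SCALE**, the statement of
`Cruxes/PoloidalWindowRigidity/Lines/sparse_energy.lean` VERBATIM.  For a profile of the route's Type-I class (Type-I time decay with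
constant `C`, continuity on `(−∞,0) × ℝ³`, Oseen mildness between any two negative times, divergence-free slices; no poloidality needed)
there is `K ≥ 0` with, for every `t₀ < 0`, every centre `a` and every radius `R > 0`:
`∫⁻_{B_R(a)} |v(t₀,x)|² dx ≤ K·R` and `∫⁻_{t<t₀} ∫⁻_{B_R(a)} ‖∇v(t,x)‖² dx dt ≤ K·R`.
Proof: `scaledEnergy_of_split` (far half + three near-apex rounds modulo the window pressure split) with the window pressure split of the class
`window_split`. [folklore] -/
theorem stub_scaledEnergy :
    ∀ (C : ℝ) (v : ℝ → EuclideanSpace ℝ (Fin 3) → EuclideanSpace ℝ (Fin 3)),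
      Literature.Analysis.FluidPDE.HasTypeITimeDecay C v →
      ContinuousOn (Function.uncurry v) (Set.Iio (0 : ℝ) ×ˢ Set.univ) →
      (∀ s t : ℝ, s < t → t < 0 → ∀ x, v t x =
        Literature.Analysis.UnboundedOperators.heatExtension (v s) (t - s) x -
          Literature.Analysis.FluidPDE.oseenDuhamel 1 s v v t x) →
      (∀ t < 0, Literature.Analysis.FluidPDE.VectorCalculus.IsDivFree (v t)) →
      ∃ K : ℝ, 0 ≤ K ∧ ∀ t₀ : ℝ, t₀ < 0 → ∀ (a : EuclideanSpace ℝ (Fin 3)) (R : ℝ), 0 < R →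
        (∫⁻ x in Metric.ball a R, ENNReal.ofReal (‖v t₀ x‖ ^ 2)) ≤ ENNReal.ofReal (K * R) ∧
        (∫⁻ t in Set.Iio t₀, ∫⁻ x in Metric.ball a R, ENNReal.ofReal (‖fderiv ℝ (v t) x‖ ^ 2)) ≤ ENNReal.ofReal (K * R) := by
  intro C v hrate hcont hmild hdiv
  obtain ⟨κ₁, κ₂, hκ₁, hκ₂, hwin⟩ := window_split hrate hcont hmild hdiv
  exact scaledEnergy_of_split hrate hcont hmild hdiv hκ₁ hκ₂ hwin

/-- `stub_scaledEnergy` in hypothesis form (the shape consumed by `scaledEnergy_of_split`'s siblings and by S3 `stub_planeMeansVanish`'s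
users): the scale-invariant energy bound `K` of a class profile. [folklore] -/
theorem scaledEnergy {C : ℝ} {v : ℝ → EuclideanSpace ℝ (Fin 3) → EuclideanSpace ℝ (Fin 3)} (hrate : HasTypeITimeDecay C v)
    (hcont : ContinuousOn (uncurry v) (Iio (0 : ℝ) ×ˢ univ))
    (hmild : ∀ s t : ℝ, s < t → t < 0 → ∀ x,
      v t x = UnboundedOperators.heatExtension (v s) (t - s) x - oseenDuhamel 1 s v v t x)
    (hdiv : ∀ t < 0, VectorCalculus.IsDivFree (v t)) :
    ∃ K : ℝ, 0 ≤ K ∧ ∀ t₀ : ℝ, t₀ < 0 → ∀ (a : EuclideanSpace ℝ (Fin 3)) (R : ℝ), 0 < R →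
      (∫⁻ x in ball a R, ENNReal.ofReal (‖v t₀ x‖ ^ 2)) ≤ ENNReal.ofReal (K * R) ∧
      (∫⁻ t in Iio t₀, ∫⁻ x in ball a R, ENNReal.ofReal (‖fderiv ℝ (v t) x‖ ^ 2)) ≤ ENNReal.ofReal (K * R) :=
  stub_scaledEnergy C v hrate hcont hmild hdiv

end Summit.NavierStokesRegularity.NavierStokesRegularity.Theorems.PoloidalWindowDoorPoloidalWindowRigiditySparseEnergyScaledEnergy

end
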